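import Mathlib
import Summits.Ventures.PercRepro2.LocRows
import Summits.Ventures.PercRepro2.SwRow
import Summits.Ventures.PercRepro2.SwAllRow
import Summits.Ventures.PercRepro2.SwPair

/-!
# Rows 2′JD and 2′JDr: joint domination of the two clusters of `h` on `Q`
(blind cell PercRepro2, night-4 g7, 2026-08-25; proofs/NIGHT4-G6.md §4.3, §8, §11)

On `Q = {h ∉ H_l, o ∈ R_side(l)}` row (SW) asks for an injection `Φ` with `C_R(h)(ζ) ⊆ C_B(h)(Φ ζ)`.
Row 2′JD (JOINT DOMINATION) asks for a permutation of `Q` under which the relation is two-sided: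
`C_R(h)(ζ) ⊆ C_B(h)(Φ ζ)` AND `C_R(h)(Φ ζ) ⊆ C_B(h)(ζ)` — the pairing form `SwPair` without the
involution requirement (a perfect matching of the symmetric relation instead of a symmetric perfect
matching).  Row 2′JDr is its RIGID form: every red edge inside `C_R(h)(ζ)` is blue in `Φ ζ` and every
red edge inside `C_R(h)(Φ ζ)` is blue in `ζ`.  Census (exact max-flow / Hall, night-4 g6, engine twin):
0 failures on all connected graphs with `n ≤ 7` for both rows.

The ladder in the kernel: `SwPair ⟹ JointDom ⟹ Sw` and `JointDomR ⟹ JointDom`,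
`JointDomR ⟹ SwAll ⟹ Sw`, with the `_all` closures over all finite multigraphs.
-/

namespace Summit.Ventures.PercRepro2

namespace LocRows

open Hull

variable {V : Type*} {E : Type*} [Fintype E] [DecidableEq E]

open scoped Classical

variable (ends : E → Sym2 V)

/-- **Row 2′JD (joint domination)**: an injection of `Q = {h ∉ H_l, o ∈ R_side(l)}` into itself
under which the red cluster of `h` of the source lies inside the blue cluster of `h` of the image
AND the red cluster of `h` of the image lies inside the blue cluster of `h` of the source. -/
def JointDom (l h o : V) : Prop :=
  ∃ f : {ζ // ζ ∈ tgtU ends l h {S : Set V | o ∈ S}} → Config E, Function.Injective f ∧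
    ∀ x, f x ∈ tgtU ends l h {S : Set V | o ∈ S} ∧
      cluster ends x.1 h ⊆ cluster ends (blue (f x)) h ∧
      cluster ends (f x) h ⊆ cluster ends (blue x.1) h

/-- **Row 2′JDr (rigid joint domination)**: an injection of `Q` into itself under which every red
edge inside the red cluster of `h` of the source is blue in the image AND every red edge inside the
red cluster of `h` of the image is blue in the source. -/
def JointDomR (l h o : V) : Prop :=
  ∃ f : {ζ // ζ ∈ tgtU ends l h {S : Set V | o ∈ S}} → Config E, Function.Injective f ∧
    ∀ x, f x ∈ tgtU ends l h {S : Set V | o ∈ S} ∧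
      (∀ e, e ∈ within ends (cluster ends x.1 h) → x.1 e = true → f x e = false) ∧
      (∀ e, e ∈ within ends (cluster ends (f x) h) → f x e = true → x.1 e = false)

/-- **Joint domination gives row (SW)** (forget the second clause). -/
theorem sw_of_jointDom {l h o : V} (hj : JointDom ends l h o) : Sw ends l h o := by
  obtain ⟨f, hf, hmem⟩ := hj
  exact ⟨f, hf, fun x => ⟨(hmem x).1, (hmem x).2.1⟩⟩

/-- **The rigid form gives row 2′SW-ALL** (forget the second clause). -/
theorem swAll_of_jointDomR {l h o : V} (hj : JointDomR ends l h o) : SwAll ends l h o := by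
  obtain ⟨f, hf, hmem⟩ := hj
  exact ⟨f, hf, fun x => ⟨(hmem x).1, (hmem x).2.1⟩⟩

/-- **The rigid form gives joint domination**: a red-connected cluster all of whose red edges are
blue in the other configuration lies inside the other configuration's blue cluster
(`cluster_subset_of_red_flipped`, both ways). -/
theorem jointDom_of_jointDomR {l h o : V} (hj : JointDomR ends l h o) : JointDom ends l h o := by
  obtain ⟨f, hf, hmem⟩ := hj
  refine ⟨f, hf, fun x => ⟨(hmem x).1, ?_, ?_⟩⟩
  · exact cluster_subset_of_red_flipped ends (hmem x).2.1
  · exact cluster_subset_of_red_flipped ends (hmem x).2.2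

/-- **The pairing form gives joint domination**: an involution of `Q` is a permutation of `Q`. -/
theorem jointDom_of_swPair {l h o : V} (hp : SwPair ends l h o) : JointDom ends l h o := by
  obtain ⟨τ, hmem, hinv, hcl⟩ := hp
  refine ⟨fun x => τ x.1, ?_, fun x => ⟨hmem x.1 x.2, (hcl x.1 x.2).1, (hcl x.1 x.2).2⟩⟩
  intro x y hxy
  have h1 : τ (τ x.1) = τ (τ y.1) := congrArg τ hxy
  rw [hinv x.1 x.2, hinv y.1 y.2] at h1
  exact Subtype.ext h1

/-- Row 2′JD over all finite graphs and markings. -/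
def JointDom_all : Prop :=
  ∀ (V E : Type) [Fintype V] [DecidableEq V] [Fintype E] [DecidableEq E] (ends : E → Sym2 V)
    (l h o : V), l ≠ h → o ≠ l → o ≠ h → JointDom ends l h o

/-- Row 2′JDr over all finite graphs and markings. -/
def JointDomR_all : Prop :=
  ∀ (V E : Type) [Fintype V] [DecidableEq V] [Fintype E] [DecidableEq E] (ends : E → Sym2 V)
    (l h o : V), l ≠ h → o ≠ l → o ≠ h → JointDomR ends l h o

/-- `JointDom_all` gives `Sw_all` (hence the free-fibre row 2′DOM and (BASE) everywhere). -/
theorem sw_all_of_jointDom_all (hj : JointDom_all) : Sw_all := by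
  intro V E _ _ _ _ ends l h o hlh hol hoh
  exact sw_of_jointDom ends (hj V E ends l h o hlh hol hoh)

/-- `JointDomR_all` gives `SwAll_all`. -/
theorem swAll_all_of_jointDomR_all (hj : JointDomR_all) : SwAll_all := by
  intro V E _ _ _ _ ends l h o hlh hol hoh
  exact swAll_of_jointDomR ends (hj V E ends l h o hlh hol hoh)

/-- `JointDomR_all` gives `JointDom_all`. -/
theorem jointDom_all_of_jointDomR_all (hj : JointDomR_all) : JointDom_all := by
  intro V E _ _ _ _ ends l h o hlh hol hoh
  exact jointDom_of_jointDomR ends (hj V E ends l h o hlh hol hoh)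

/-- `SwPair_all` gives `JointDom_all`. -/
theorem jointDom_all_of_swPair_all (hp : SwPair_all) : JointDom_all := by
  intro V E _ _ _ _ ends l h o hlh hol hoh
  exact jointDom_of_swPair ends (hp V E ends l h o hlh hol hoh)

end LocRows

end Summit.Ventures.PercRepro2
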